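import Summits.QuantumFields.YangMills.Theorems.FluctuationComparisonRegPrIntLOrganTangentSliceOfTubeAnalytic
import Summits.QuantumFields.YangMills.Theorems.FluctuationComparisonRegPrIntLOrganTangentOneLoopLettersOfHolomorphy
import HarnessLib

/-!
# Route `UnitScaleTilt`, crux stmt-QuantumFields-20520 `FluctuationComparisonRegPrIntL`, PATH-B organ (covariant organ of record, RULING №56),
# group (I-curv) ∕ SPEC v1.8 (xv) — **THE COMPLEXIFIED NEAR SQUARE FEEDS THE ONE-LOOP KNIT.**  The complex two-bond square of ✓p827459
# (`(σ,τ) ↦ U·expPointC(σ•ŵ)@b·expPointC(τ•ŵ′)@b′`, entire, inside Bałaban's tube for `|σ|, |τ| < r`, `e^{6r} ≤ 1 + δ`) is EXPORTED as an object, and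
# composed with any OPERATOR-VALUED map `G` holomorphic and bounded on the tube ([Balaban1987RG1] (1.11)–(1.18): «analytic on the space U^c_j(X, α₀, α₁)»)
# it yields the separately-holomorphic, bounded two-parameter families that ✓p827764 `…OneLoopLettersOfHolomorphy` consumes; hence the (xv) pointwise
# bilinear bound for `K⁻¹H` over a REAL near coarse square ⟸ {`K`, `H` tube-holomorphic and bounded as functions of the complex configuration, corner
# inverse bound} — by name, in one theorem.

Cell `ym3-torus`, WIDTH COPY «width 19» of ★p1 (seat `ym3-torus-px19`, gen 23); `--supports stmt-QuantumFields-20520 --as helper`; count-neutral;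
def-free.  INHABITATION (★★OWNER RULING №100): LAW-FREE — `G` = the complex extension of `V ↦ K_V` (the whitened covariant chart's fluctuation
operator) or of `V ↦ H^O_V` around the window configuration `U`; own analyticity of the chart objects ([Balaban1985Variational] Prop. 9 p.309;
[Balaban1987RG1] (1.5), p.261 «analytic functions of the configurations»); no fibre law, no score, no cross-law object.

WHAT THIS FILE PROVES (sorry-free; `M₂(ℂ)` with the L²-operator norm; `𝒳` any complex normed space; `R` any complex normed algebra).
* §1 ★★`exists_cplxSquare` — THE COMPLEX TWO-BOND SQUARE AS AN OBJECT: for `U`, bonds `b, b′`, sup-unit directions `w, w′` and `e^{6r} ≤ 1 + δ` there is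
  `Φ : ℂ × ℂ → (bonds → M₂(ℂ))`, ENTIRE, mapping `ball 0 r ×ˢ ball 0 r` into `cplxTube δ U`, with `Φ 0 = ι∘U` and `Φ(s,t) = ι∘Z` for the REAL two-bond
  move `Z = U·expPt(s•w)@b·expPt(t•w′)@b′` (the construction of ✓p827459, exported; lit ✓`B15SU2ChartHolomorphic.expPointC`).
* §2 ★★`squareFamily_of_tubeHolo` — for `G : (bonds → M₂(ℂ)) → 𝒳` DifferentiableOn the tube with `‖G‖ ≤ M_G` there: the family `Ksq σ τ := G (Φ(σ,τ))` is
  SEPARATELY HOLOMORPHIC on `ball 0 r × ball 0 r`, bounded by `M_G`, and equals `G(ι∘Z)` at real parameters — the three letters `hKσ∕hKτ∕hKM` of ✓p827764.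
* §3 ★★★`norm_doubleDiff_inv_mul_le_of_tubeHolo` — THE CHAIN: `K, H : (bonds → M₂(ℂ)) → R` tube-holomorphic with `‖K‖ ≤ M_K`, `‖H‖ ≤ M_H`; a REAL near
  square `U, V = U·e^{sw}@b, Y = U·e^{tw′}@b′, Z = V·e^{tw′}@b′` with `0 ≤ s, t ≤ r∕4`; two-sided inverses of `K(ι∘U), K(ι∘V), K(ι∘Y), K(ι∘Z)` with norms
  `≤ a` ⟹ `‖A_Z·H(ι∘Z) − A_V·H(ι∘V) − A_Y·H(ι∘Y) + A_U·H(ι∘U)‖ ≤ C(a, M_K, M_H, r)·s·t`, `C` the explicit polynomial of ✓p827764 at `ρ = ρ′ = r` (the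
  trace form follows by composing with a bounded additive functional exactly as in ✓`abs_doubleDiff_functional_le_of_holo`).

WHAT STAYS FOR THE DISCHARGER: the m-UNIFORMITY of `(M_K, M_H, r, a)` and the `tdist`-decay after the trace (LEAD №20's layer (2);
[Balaban1984PropagatorsII] ∕ [Balaban1985BackgroundPropagators]); the existence of the tube-holomorphic extensions `K, H` of the chart objects.
HONEST SCOPE: bookkeeping over ✓p827459 ∕ ✓p827764 ∕ ✓p827474; nothing of Bałaban's operators constructed; (xv)∕(I-curv)∕D0, rows v0.1–v0.4,
`SpreadFibreLawH(J)(sq)` UNDISCHARGED; the five registered stubs, 20520, 19936, 19200, `YM3TorusSU2` NOT proved; no summit is proved by a helper.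
R3 = SU(2) YM₃ on T³ — NOT d = 4, NOT infinite volume, NOT a mass gap, NOT Clay; the Yang–Mills mass gap is NOT proved.

References: T. Bałaban, CMP **109** (1987) 249–301 [Balaban1987RG1] ((1.11)–(1.18) pp.262–263, (3.15)–(3.17) p.273); CMP **102** (1985) 277–309
[Balaban1985Variational] (Prop. 9 p.309); CMP **99** (1985) 389–434 [Balaban1985BackgroundPropagators].
-/

noncomputable section

open Function Metric Set
open scoped Matrix.Norms.L2Operator
open Literature.MathematicalPhysics.QuantumFieldTheory.Balaban1983to89
open T4CubeChartExp (expPt expPt_zero)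
open B15SU2ChartHolomorphic (expPointC)
open BalabanUVClass (CplxModel)
open Summit.QuantumFields.YangMills.Theorems.OrganTangentSliceOfTubeAnalytic
  (norm_expPointC_smul_sub_one_le coe_expPt_smul differentiable_expPointC_smul differentiable_update_mul norm_update_mul_sub_le)
open Summit.QuantumFields.YangMills.Theorems.OrganTangentOneLoopLettersOfHolomorphy
  (norm_doubleDiff_inv_mul_le_of_holo abs_doubleDiff_functional_le_of_holo)

namespace Summit.QuantumFields.YangMills.Theorems.OrganTangentSquareOfTubeHolomorphic

variable {P : Params} {j : ℕ} [DecidableEq (PBond P j)]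

/-! ## §1 The complex two-bond square as an object -/

/-- ★★ **THE COMPLEX TWO-BOND SQUARE** through `U` at bonds `b, b′` in sup-unit directions `w, w′` (radius `r` with `e^{6r} ≤ 1 + δ`): an ENTIRE map
`Φ : ℂ × ℂ → (bonds → M₂(ℂ))` into the tube `cplxTube δ U` on the bidisc `ball 0 r ×ˢ ball 0 r`, equal to `ι∘U` at `0` and to the embedded REAL two-bond
move `ι∘Z` at real parameters `(s, t)` (the construction inside ✓p827459, exported). [cite: Balaban1987RG1, (1.11)-(1.13) p.262] -/
theorem exists_cplxSquare (U : GaugeField P j (Matrix.specialUnitaryGroup (Fin 2) ℂ)) {δ r : ℝ}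
    (hr : Real.exp (6 * r) ≤ 1 + δ) (b b' : PBond P j) (w w' : Fin 3 → ℝ) (hw : ‖w‖ ≤ 1) (hw' : ‖w'‖ ≤ 1) :
    ∃ Φ : ℂ × ℂ → (PBond P j → Matrix (Fin 2) (Fin 2) ℂ),
      Differentiable ℂ Φ ∧
      MapsTo Φ (ball (0 : ℂ) r ×ˢ ball (0 : ℂ) r) ((CplxModel.specialUnitary (Fin 2)).cplxTube δ U) ∧
      Φ 0 = (CplxModel.specialUnitary (Fin 2)).embed U ∧
      ∀ (s t : ℝ) (V Z : GaugeField P j (Matrix.specialUnitaryGroup (Fin 2) ℂ)),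
        (∀ e, e ≠ b → V e = U e) → V b = U b * expPt (s • w) → (∀ e, e ≠ b' → Z e = V e) → Z b' = V b' * expPt (t • w') →
        Φ ((s : ℂ), (t : ℂ)) = (CplxModel.specialUnitary (Fin 2)).embed Z := by
  set M := CplxModel.specialUnitary (Fin 2) with hM
  set cw : EuclideanSpace ℂ (Fin 3) := WithLp.toLp 2 (fun a => ((w a : ℝ) : ℂ)) with hcw
  set cw' : EuclideanSpace ℂ (Fin 3) := WithLp.toLp 2 (fun a => ((w' a : ℝ) : ℂ)) with hcw'
  set f₀ : PBond P j → Matrix (Fin 2) (Fin 2) ℂ := fun e => ((U e : Matrix.specialUnitaryGroup (Fin 2) ℂ) : Matrix (Fin 2) (Fin 2) ℂ)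
    with hf₀
  have hembU : M.embed U = f₀ := by funext e; rfl
  set W₁ : ℂ × ℂ → PBond P j → Matrix (Fin 2) (Fin 2) ℂ := fun z => update f₀ b (f₀ b * expPointC (z.1 • cw)) with hW₁
  set Φ : ℂ × ℂ → PBond P j → Matrix (Fin 2) (Fin 2) ℂ := fun z => update (W₁ z) b' (W₁ z b' * expPointC (z.2 • cw')) with hΦ
  have hW₁d : Differentiable ℂ W₁ :=
    differentiable_update_mul (differentiable_const _) (differentiable_expPointC_smul (ContinuousLinearMap.fst ℂ ℂ ℂ) cw) b
  have hΦd : Differentiable ℂ Φ :=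
    differentiable_update_mul hW₁d (differentiable_expPointC_smul (ContinuousLinearMap.snd ℂ ℂ ℂ) cw') b'
  have hf₀1 : ∀ e, ‖f₀ e‖ ≤ 1 := fun e => M.norm_le_one (U e)
  have hmaps : MapsTo Φ (ball (0 : ℂ) r ×ˢ ball (0 : ℂ) r) (M.cplxTube δ U) := by
    intro z hz
    rw [mem_prod, mem_ball_zero_iff, mem_ball_zero_iff] at hz
    have hr0 : 0 < r := (norm_nonneg _).trans_lt hz.1
    have h1 : ‖expPointC (z.1 • cw) - 1‖ ≤ Real.exp (3 * r) - 1 :=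
      (norm_expPointC_smul_sub_one_le z.1 hw).trans (by gcongr; exact hz.1.le)
    have h2 : ‖expPointC (z.2 • cw') - 1‖ < Real.exp (3 * r) - 1 :=
      (norm_expPointC_smul_sub_one_le z.2 hw').trans_lt (by gcongr; exact hz.2)
    have hA0 : 0 ≤ Real.exp (3 * r) - 1 := by linarith [Real.add_one_le_exp (3 * r)]
    have hW₁A : ∀ e, ‖W₁ z e - f₀ e‖ ≤ Real.exp (3 * r) - 1 := fun e => by
      have := norm_update_mul_sub_le (F := f₀) (f₀ := f₀) le_rfl hA0 hf₀1 (fun e => by simp) h1 b e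
      simpa using this
    intro e
    show ‖Φ z e - M.ι (U e)‖ < δ
    have hιe : M.ι (U e) = f₀ e := rfl
    rw [hιe]
    by_cases he : e = b'
    · subst he
      have hFb : ‖W₁ z e‖ ≤ 1 + (Real.exp (3 * r) - 1) := by
        calc ‖W₁ z e‖ = ‖f₀ e + (W₁ z e - f₀ e)‖ := by rw [add_sub_cancel]
          _ ≤ ‖f₀ e‖ + ‖W₁ z e - f₀ e‖ := norm_add_le _ _
          _ ≤ 1 + (Real.exp (3 * r) - 1) := add_le_add (hf₀1 e) (hW₁A e)
      have hpos : 0 < 1 + (Real.exp (3 * r) - 1) := by linarith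
      calc ‖Φ z e - f₀ e‖ = ‖W₁ z e * expPointC (z.2 • cw') - f₀ e‖ := by simp [hΦ]
        _ = ‖W₁ z e * (expPointC (z.2 • cw') - 1) + (W₁ z e - f₀ e)‖ := by rw [mul_sub, mul_one, sub_add_sub_cancel]
        _ ≤ ‖W₁ z e‖ * ‖expPointC (z.2 • cw') - 1‖ + ‖W₁ z e - f₀ e‖ :=
            (norm_add_le _ _).trans (add_le_add (norm_mul_le _ _) le_rfl)
        _ < (1 + (Real.exp (3 * r) - 1)) * (Real.exp (3 * r) - 1) + (Real.exp (3 * r) - 1) := by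
            apply add_lt_add_of_lt_of_le _ (hW₁A e)
            calc ‖W₁ z e‖ * ‖expPointC (z.2 • cw') - 1‖ ≤ (1 + (Real.exp (3 * r) - 1)) * ‖expPointC (z.2 • cw') - 1‖ := by
                  gcongr
              _ < (1 + (Real.exp (3 * r) - 1)) * (Real.exp (3 * r) - 1) := by gcongr
        _ = Real.exp (3 * r) * Real.exp (3 * r) - 1 := by ring
        _ = Real.exp (6 * r) - 1 := by rw [← Real.exp_add]; ring_nf
        _ ≤ δ := by linarith
    · have hΦe : Φ z e = W₁ z e := by simp [hΦ, update_of_ne he]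
      rw [hΦe]
      by_cases heb : e = b
      · subst heb
        have h1' : ‖expPointC (z.1 • cw) - 1‖ < Real.exp (3 * r) - 1 :=
          (norm_expPointC_smul_sub_one_le z.1 hw).trans_lt (by gcongr; exact hz.1)
        calc ‖W₁ z e - f₀ e‖ = ‖f₀ e * (expPointC (z.1 • cw) - 1)‖ := by simp [hW₁, mul_sub]
          _ ≤ ‖f₀ e‖ * ‖expPointC (z.1 • cw) - 1‖ := norm_mul_le _ _
          _ < 1 * (Real.exp (3 * r) - 1) := by
              calc ‖f₀ e‖ * ‖expPointC (z.1 • cw) - 1‖ ≤ 1 * ‖expPointC (z.1 • cw) - 1‖ := by gcongr; exact hf₀1 e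
                _ < 1 * (Real.exp (3 * r) - 1) := by gcongr
          _ ≤ Real.exp (6 * r) - 1 := by
              rw [one_mul]; gcongr; linarith
          _ ≤ δ := by linarith
      · have : W₁ z e = f₀ e := by simp [hW₁, update_of_ne heb]
        rw [this, sub_self, norm_zero]
        have : Real.exp (3 * r) - 1 < Real.exp (6 * r) - 1 := by gcongr; linarith
        linarith
  have hexp0 : expPointC 0 = 1 := by rw [expPointC]; simp
  have hΦ0 : Φ 0 = M.embed U := by
    rw [hembU]; funext e
    simp [hΦ, hW₁, hexp0]
  have hΦreal : ∀ (s t : ℝ) (V Z : GaugeField P j (Matrix.specialUnitaryGroup (Fin 2) ℂ)),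
      (∀ e, e ≠ b → V e = U e) → V b = U b * expPt (s • w) → (∀ e, e ≠ b' → Z e = V e) → Z b' = V b' * expPt (t • w') →
      Φ ((s : ℂ), (t : ℂ)) = M.embed Z := by
    intro s t V Z hV hVb hZ hZb
    have hW₁V : W₁ ((s : ℂ), (t : ℂ)) = M.embed V := by
      funext e
      by_cases he : e = b
      · subst he
        simp only [hW₁, update_self]
        show f₀ e * expPointC ((s : ℂ) • cw) = M.ι (V e)
        rw [hVb, map_mul]
        show f₀ e * expPointC ((s : ℂ) • cw) = M.ι (U e) * ((expPt (s • w) : Matrix.specialUnitaryGroup (Fin 2) ℂ) : Matrix (Fin 2) (Fin 2) ℂ)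
        rw [coe_expPt_smul]; rfl
      · simp only [hW₁, update_of_ne he]
        show f₀ e = M.ι (V e)
        rw [hV e he]; rfl
    funext e
    by_cases he : e = b'
    · subst he
      simp only [hΦ, update_self]
      rw [hW₁V]
      show M.ι (V e) * expPointC ((t : ℂ) • cw') = M.ι (Z e)
      rw [hZb, map_mul]
      show M.ι (V e) * expPointC ((t : ℂ) • cw') = M.ι (V e) * ((expPt (t • w') : Matrix.specialUnitaryGroup (Fin 2) ℂ) : Matrix (Fin 2) (Fin 2) ℂ)
      rw [coe_expPt_smul]
    · simp only [hΦ, update_of_ne he]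
      rw [hW₁V]
      show M.ι (V e) = M.ι (Z e)
      rw [hZ e he]
  exact ⟨Φ, hΦd, hmaps, hΦ0, hΦreal⟩

/-! ## §2 Operator-valued tube-holomorphic maps along the square: the letters of ✓p827764 -/

/-- ★★ **THE SQUARE FAMILY OF A TUBE-HOLOMORPHIC MAP**: for `G : (bonds → M₂(ℂ)) → 𝒳` differentiable on `cplxTube δ U` with `‖G W‖ ≤ M_G` there, the
two-parameter family `Ksq σ τ := G(Φ(σ,τ))` along the complex square of §1 is separately holomorphic on `ball 0 r × ball 0 r`, bounded by `M_G`, and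
equals `G(ι∘Z)` at real parameters `(s,t)`, `|s|, |t| < r` — exactly the hypotheses `hKσ, hKτ, hKM` of ✓`norm_doubleDiff_inv_mul_le_of_holo`.
[cite: Balaban1987RG1, (1.18) p.263] -/
theorem squareFamily_of_tubeHolo {𝒳 : Type*} [NormedAddCommGroup 𝒳] [NormedSpace ℂ 𝒳]
    (U : GaugeField P j (Matrix.specialUnitaryGroup (Fin 2) ℂ)) {δ r MG : ℝ} (hr : Real.exp (6 * r) ≤ 1 + δ)
    (G : (PBond P j → Matrix (Fin 2) (Fin 2) ℂ) → 𝒳)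
    (hG : DifferentiableOn ℂ G ((CplxModel.specialUnitary (Fin 2)).cplxTube δ U))
    (hGM : ∀ W ∈ (CplxModel.specialUnitary (Fin 2)).cplxTube δ U, ‖G W‖ ≤ MG)
    (b b' : PBond P j) (w w' : Fin 3 → ℝ) (hw : ‖w‖ ≤ 1) (hw' : ‖w'‖ ≤ 1) :
    ∃ Ksq : ℂ → ℂ → 𝒳,
      (∀ τ ∈ ball (0 : ℂ) r, DifferentiableOn ℂ (fun σ => Ksq σ τ) (ball (0 : ℂ) r)) ∧
      (∀ σ ∈ ball (0 : ℂ) r, DifferentiableOn ℂ (Ksq σ) (ball (0 : ℂ) r)) ∧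
      (∀ σ ∈ ball (0 : ℂ) r, ∀ τ ∈ ball (0 : ℂ) r, ‖Ksq σ τ‖ ≤ MG) ∧
      ∀ (s t : ℝ) (V Z : GaugeField P j (Matrix.specialUnitaryGroup (Fin 2) ℂ)),
        (∀ e, e ≠ b → V e = U e) → V b = U b * expPt (s • w) → (∀ e, e ≠ b' → Z e = V e) → Z b' = V b' * expPt (t • w') →
        Ksq (s : ℂ) (t : ℂ) = G ((CplxModel.specialUnitary (Fin 2)).embed Z) := by
  obtain ⟨Φ, hΦd, hmaps, _, hΦreal⟩ := exists_cplxSquare U hr b b' w w' hw hw'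
  refine ⟨fun σ τ => G (Φ (σ, τ)), ?_, ?_, ?_, ?_⟩
  · intro τ hτ
    have hline : Differentiable ℂ (fun σ : ℂ => Φ (σ, τ)) :=
      hΦd.comp (differentiable_id.prodMk (differentiable_const τ))
    refine hG.comp hline.differentiableOn fun σ hσ => hmaps ?_
    exact mem_prod.mpr ⟨hσ, hτ⟩
  · intro σ hσ
    have hline : Differentiable ℂ (fun τ : ℂ => Φ (σ, τ)) :=
      hΦd.comp ((differentiable_const σ).prodMk differentiable_id)
    refine hG.comp hline.differentiableOn fun τ hτ => hmaps ?_
    exact mem_prod.mpr ⟨hσ, hτ⟩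
  · intro σ hσ τ hτ
    exact hGM _ (hmaps (mem_prod.mpr ⟨hσ, hτ⟩))
  · intro s t V Z hV hVb hZ hZb
    show G (Φ ((s : ℂ), (t : ℂ))) = _
    rw [hΦreal s t V Z hV hVb hZ hZb]

/-! ## §3 The chain: tube-holomorphic `K`, `H` ⟹ the (xv) bilinear bound over a real near square -/

section Chain

variable {R : Type*} [NormedRing R] [NormedAlgebra ℂ R]

/-- ★★★ **THE (xv) POINTWISE BILINEAR BOUND FROM TUBE HOLOMORPHY.**  `K, H : (bonds → M₂(ℂ)) → R` differentiable on `cplxTube δ U` with `‖K‖ ≤ M_K`,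
`‖H‖ ≤ M_H` there (`e^{6r} ≤ 1 + δ`, `0 < r`); a REAL near coarse square `U`, `V = U·expPt(s•w)@b`, `Y = U·expPt(t•w′)@b′`, `Z = V·expPt(t•w′)@b′` with
`0 ≤ s, t ≤ r∕4` and sup-unit `w, w′`; two-sided inverses `A_U, A_V, A_Y, A_Z` of `K` at the four embedded corners with norms `≤ a` ⟹
`‖A_Z·H(ι∘Z) − A_V·H(ι∘V) − A_Y·H(ι∘Y) + A_U·H(ι∘U)‖ ≤ C(a, M_K, M_H, r)·s·t` with ✓p827764's explicit `C` at `ρ = ρ′ = r`.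
[cite: Balaban1987RG1, (1.18) p.263 and (3.15)-(3.17) p.273] -/
theorem norm_doubleDiff_inv_mul_le_of_tubeHolo
    (U : GaugeField P j (Matrix.specialUnitaryGroup (Fin 2) ℂ)) {δ r MK MH a : ℝ} (hr0 : 0 < r) (hr : Real.exp (6 * r) ≤ 1 + δ)
    (K H : (PBond P j → Matrix (Fin 2) (Fin 2) ℂ) → R)
    (hK : DifferentiableOn ℂ K ((CplxModel.specialUnitary (Fin 2)).cplxTube δ U))
    (hKM : ∀ W ∈ (CplxModel.specialUnitary (Fin 2)).cplxTube δ U, ‖K W‖ ≤ MK)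
    (hH : DifferentiableOn ℂ H ((CplxModel.specialUnitary (Fin 2)).cplxTube δ U))
    (hHM : ∀ W ∈ (CplxModel.specialUnitary (Fin 2)).cplxTube δ U, ‖H W‖ ≤ MH)
    (b b' : PBond P j) (w w' : Fin 3 → ℝ) (hw : ‖w‖ ≤ 1) (hw' : ‖w'‖ ≤ 1)
    {s t : ℝ} (hs0 : 0 ≤ s) (hsr : s ≤ r / 4) (ht0 : 0 ≤ t) (htr : t ≤ r / 4)
    (V Y Z : GaugeField P j (Matrix.specialUnitaryGroup (Fin 2) ℂ))
    (hV : ∀ e, e ≠ b → V e = U e) (hVb : V b = U b * expPt (s • w))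
    (hY : ∀ e, e ≠ b' → Y e = U e) (hYb : Y b' = U b' * expPt (t • w'))
    (hZ : ∀ e, e ≠ b' → Z e = V e) (hZb : Z b' = V b' * expPt (t • w'))
    {AU AV AY AZ : R}
    (hlU : AU * K ((CplxModel.specialUnitary (Fin 2)).embed U) = 1) (hrU : K ((CplxModel.specialUnitary (Fin 2)).embed U) * AU = 1)
    (hlV : AV * K ((CplxModel.specialUnitary (Fin 2)).embed V) = 1) (hrV : K ((CplxModel.specialUnitary (Fin 2)).embed V) * AV = 1)
    (hlY : AY * K ((CplxModel.specialUnitary (Fin 2)).embed Y) = 1) (hrY : K ((CplxModel.specialUnitary (Fin 2)).embed Y) * AY = 1)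
    (hlZ : AZ * K ((CplxModel.specialUnitary (Fin 2)).embed Z) = 1) (hrZ : K ((CplxModel.specialUnitary (Fin 2)).embed Z) * AZ = 1)
    (hAU : ‖AU‖ ≤ a) (hAV : ‖AV‖ ≤ a) (hAY : ‖AY‖ ≤ a) (hAZ : ‖AZ‖ ≤ a) :
    ‖AZ * H ((CplxModel.specialUnitary (Fin 2)).embed Z) - AV * H ((CplxModel.specialUnitary (Fin 2)).embed V)
        - AY * H ((CplxModel.specialUnitary (Fin 2)).embed Y) + AU * H ((CplxModel.specialUnitary (Fin 2)).embed U)‖ ≤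
      (a * (16 * MH / (r * r)) + a ^ 2 * ((4 * MK / r) * (4 * MH / r) + (4 * MK / r) * (4 * MH / r)) +
        (a ^ 2 * (16 * MK / (r * r)) + 2 * a ^ 3 * (4 * MK / r) * (4 * MK / r)) * MH) * s * t := by
  set M := CplxModel.specialUnitary (Fin 2) with hM
  obtain ⟨Ksq, hKσ, hKτ, hKsqM, hKreal⟩ := squareFamily_of_tubeHolo U hr K hK hKM b b' w w' hw hw'
  obtain ⟨Hsq, hHσ, hHτ, hHsqM, hHreal⟩ := squareFamily_of_tubeHolo U hr H hH hHM b b' w w' hw hw'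
  -- the four real corners of the two families
  have hU0 : ∀ e, e ≠ b → U e = U e := fun _ _ => rfl
  have hUb : U b = U b * expPt ((0 : ℝ) • w) := by rw [zero_smul, expPt_zero, mul_one]
  have hUU : ∀ e, e ≠ b' → U e = U e := fun _ _ => rfl
  have hUb' : U b' = U b' * expPt ((0 : ℝ) • w') := by rw [zero_smul, expPt_zero, mul_one]
  have hVV : ∀ e, e ≠ b' → V e = V e := fun _ _ => rfl
  have hVb' : V b' = V b' * expPt ((0 : ℝ) • w') := by rw [zero_smul, expPt_zero, mul_one]
  have eK00 : Ksq 0 0 = K (M.embed U) := by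
    have := hKreal 0 0 U U hU0 hUb hUU hUb'; simpa using this
  have eK10 : Ksq (s : ℂ) 0 = K (M.embed V) := by
    have := hKreal s 0 V V hV hVb hVV hVb'; simpa using this
  have eK01 : Ksq 0 (t : ℂ) = K (M.embed Y) := by
    have := hKreal 0 t U Y hU0 hUb hY hYb; simpa using this
  have eK11 : Ksq (s : ℂ) (t : ℂ) = K (M.embed Z) := hKreal s t V Z hV hVb hZ hZb
  have eH00 : Hsq 0 0 = H (M.embed U) := by
    have := hHreal 0 0 U U hU0 hUb hUU hUb'; simpa using this
  have eH10 : Hsq (s : ℂ) 0 = H (M.embed V) := by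
    have := hHreal s 0 V V hV hVb hVV hVb'; simpa using this
  have eH01 : Hsq 0 (t : ℂ) = H (M.embed Y) := by
    have := hHreal 0 t U Y hU0 hUb hY hYb; simpa using this
  have eH11 : Hsq (s : ℂ) (t : ℂ) = H (M.embed Z) := hHreal s t V Z hV hVb hZ hZb
  have h := norm_doubleDiff_inv_mul_le_of_holo (K := Ksq) (H := Hsq) hr0 hr0 hKσ hKτ hKsqM hHσ hHτ hHsqM hs0 hsr ht0 htr
    (A₀₀ := AU) (A₁₀ := AV) (A₀₁ := AY) (A₁₁ := AZ)
    (by rw [eK00]; exact hlU) (by rw [eK00]; exact hrU) (by rw [eK10]; exact hlV) (by rw [eK10]; exact hrV)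
    (by rw [eK01]; exact hlY) (by rw [eK01]; exact hrY) (by rw [eK11]; exact hlZ) (by rw [eK11]; exact hrZ)
    hAU hAV hAY hAZ
  rw [eH00, eH10, eH01, eH11] at h
  exact h

end Chain

end Summit.QuantumFields.YangMills.Theorems.OrganTangentSquareOfTubeHolomorphic
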